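/-
Copyright (c) 2026 The h413 squad. All rights reserved.
Released under Apache 2.0 license as described in the file LICENSE.
Authors: K2E3-p17 (g5) (road HC-14-ell, piece E3d∕E3e)
-/
import Summits.HodgeConjecture.HodgeConjecture.Theorems.K2E3HC13LieStretchingKit   -- ★ (this seat): scalar `p`, boxes `M₃(𝔭^k)`, weight under stretching, far out; frame of ★ `K2E3HC14EllLocalToUniform`
import HarnessLib

/-!
# K2_E3 road (h413), (SC-an) cone, road «HC-14-ell», piece E3d∕E3e: HARISH-CHANDRA'S THEOREM 13 AT THE ORIGIN BY STRETCHING ([HarishChandra1970] Part VI §7)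

Cell `pub/hodgecm-mathlib`, crux H413 = `stmt-HodgeConjecture-24833` (supports-only, `--as helper`), Track B «K2-LIT» engine E3, unit U12, leaf (SC-an)
`sig_K2E3CharLocBddSupercuspidalAnalytic` ⟸ (M5h) ⟸ the ONE residual letter «HC-14-ell» `sig_K2E3HC14EllRankOne` (Harish-Chandra's Theorem 14 for the compact
Cartan subgroups of `U(3)`), which E5 (K2E5-p01) derives from its LIE twin «HC13-Lie-ell» ((SC-an) lead K2E3-p14 (g3) cand `sig_K2E3HC13LieEllRankOne.cand.v1`):
for every compact `S ⊆ M₃(K)` ONE constant `C` with `|discr χ_X|_K^{1∕4} · ∫_U Θ(gXg⁻¹) dμ(g) ≤ C · M` for all Borel `Θ ≤ M` vanishing off `S` and all `X ∈ 𝔲(σ,J)`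
with `discr χ_X ≠ 0` and compact centraliser.  Harish-Chandra proves Theorem 13 ([HarishChandra1970] Part V §3 p. 44, Part VI §§1–7 pp. 46–60) by showing
that every point `X₀ ∈ 𝔤` is GOOD (`X₀ ∈ 𝔤₀`, VI §2 p. 51: test functions supported near `X₀` have bounded normalised orbital integrals): non-nilpotent points by
semisimple descent (Lemma 29 — road pieces E2∕E4), non-zero nilpotent points by the slice-and-stretching induction (Lemma 38 — pieces E3a∕E3b∕E3c), and finally
the ORIGIN by one more stretching `X ↦ tX` (VI §7 pp. 59–60 — piece E3d) after which compactness of the support assembles the theorem (piece E3e).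

THIS FILE types VI §7 + the assembly ON THE SEMISIMPLE PART `𝔰𝔲 = {X ∈ 𝔲 | tr X = 0}` (HC first passes to semisimple `𝔤`, VI §1 Lemmas 26–27: at a non-zero
CENTRAL point `a·1` the `𝔤₀`-property is the whole theorem again, so «every non-zero point is good» is only dischargeable on `𝔰𝔲`; the centre is put back by
the sibling `K2E3HC13LieCentreReduction`), in the letter's own currency and for ANY `σ` (continuous), ANY `J`, ANY measure `μ` on `U = ↥(unitaryGroupOfForm σ J)`:
**`hc13Lie_traceZero_of_forall_ne_zero`** — IF every non-zero `X₀ ∈ 𝔰𝔲(σ,J)` is good (hypothesis `hgood`, the Θ-form of `𝔤₁ ∖ {0} ⊆ 𝔤₀`: a window `V ∈ 𝓝 X₀`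
and a constant bounding `|discr χ_X|_K^{1∕4} ∫ Θ(gXg⁻¹) dμ ≤ C·M` for Borel `Θ ≤ M` supported in `V` and all trace-zero admissible `X`), THEN the letter's
conclusion holds at every compact `S` for all trace-zero admissible `X`.  So after this file (and the centre reduction) the Lie letter — hence, through E5, the
group letter and (SC-an) — needs EXACTLY Harish-Chandra's `𝔤₀`-statements at the non-zero points of `𝔰𝔲` and nothing at the origin or on the centre.

PROOF (HC VI §7 verbatim, positivity replacing `C_c^∞`): the stretching scalar is the residue characteristic `p` (`σ p = p`, `0 < |p|_K < 1`, kit §3); `S` lies in an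
open-compact box `B = M₃(𝔭^k)` (kit §3); `𝟙_B(p·Z) = 𝟙_B(Z) + 𝟙_{A}(Z)` with the compact annulus `A = M₃(𝔭^{k−e}) ∖ B ∌ 0` (`|p|_K = q^{-e}`), and `|discr χ_{pY}|_K^{1∕4} =
κ |discr χ_Y|_K^{1∕4}`, `κ = |p|_K^{3∕2} < 1` (★ `discr_smul_fin_three`; print: `|η(t⁻¹H)|^{1∕2} = |t|^{−(n−ℓ)∕2}|η(H)|^{1∕2}`, `n − ℓ = 6`) (kit §4; `stretching_step`); finitely
many `hgood`-windows (and the open sets `𝔲ᶜ`, `{tr ≠ 0}`, which meet no orbit of `𝔰𝔲`) cover `A`, giving `|discr χ_X|^{1∕4} Φ(𝟙_A, X) ≤ C₁` uniformly (§1); hence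
`a(pY) ≤ κ a(Y) + κ C₁` for `a(Y) = |discr χ_Y|^{1∕4} Φ(𝟙_B, Y)`; since no conjugate of `p^{−m}X` lies in `B` for `m ≫ 0` (a coefficient of the characteristic
polynomial blows up while all are bounded on `B`, kit §5 — Cor. of Lemma 28), descending induction gives `a(X) ≤ κC₁∕(1−κ) = D`, and `Θ ≤ M·𝟙_B` gives the letter with `C = D`.

* kit (sibling ★ `K2E3HC13LieStretchingKit`): invariants of `M₃` and homogeneity (§1), adjoint action (§2), scalar `p` and boxes (§3), weight∕measurability (§4), far out (§5).
* §1 here `exists_const_of_isCompact_zero_notMem` (annulus bound); §2 `stretching_step`, **`hc13Lie_traceZero_of_forall_ne_zero`**.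

HONEST LABEL: `--supports stmt-HodgeConjecture-24833 --as helper`, count-neutral; HC_CM is proved only modulo the 7 printed citations (2 remaining named inputs:
hLiu418 = `stmt-HodgeConjecture-24832`, h413 = `stmt-HodgeConjecture-24833`) until rung 0 closes; (SC-an) and the letter «HC-14-ell» are NOT proved here — this is the
origin∕assembly step of Harish-Chandra's proof on `𝔰𝔲`, conditional on the `𝔤₀`-statements at the non-zero points of `𝔰𝔲` (pieces E2∕E3a–c∕E4 of the road).

## References
* [HarishChandra1970] Harish-Chandra (notes by G. van Dijk), *Harmonic Analysis on Reductive p-adic Groups*, LNM 162 (1970): Part V §3 Theorem 13 p. 44; Part VI §1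
  Lemma 28 and Corollary p. 48, §2 Lemma 29 and the set `𝔤₀` p. 51, §6 Lemma 38 pp. 57–59, §7 «Completion of the proof of Theorem 13» pp. 59–60.
* [Rogawski1990] J. D. Rogawski, *Automorphic Representations of Unitary Groups in Three Variables*, Ann. of Math. Stud. 123 (1990), §7.3 p. 97 (`|D|^{1∕2}Φ` bounded).
* [HornJohnson2013] R. A. Horn, C. R. Johnson, *Matrix Analysis*, 2nd ed. (2013), §1.2 Problem 1.2.P18 (coefficients of the characteristic polynomial of a `3 × 3` matrix).
* [Humphreys1972] J. E. Humphreys, *Introduction to Lie Algebras and Representation Theory*, GTM 9 (1972), §23.2 (homogeneous invariant polynomials).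
* [WeilBNT1967] A. Weil, *Basic Number Theory* (1967), Ch. I §2 (the compact open balls `𝔭^k` of a local field).
-/

set_option autoImplicit false
set_option linter.dupNamespace false

noncomputable section

open MeasureTheory Measure Set Filter Topology Polynomial
open scoped NNReal ENNReal MatrixGroups WithZero
open Literature.NumberTheory.Automorphic Literature.NumberTheory.Automorphic.UnitaryGroup
open Literature.NumberTheory.GaloisRepresentations Literature.NumberTheory.GaloisRepresentations.IsNonarchimedeanLocalField

open Summit.HodgeConjecture.HodgeConjecture.Cruxes.H413.K2E3HC13LieStretchingKit

namespace Summit.HodgeConjecture.HodgeConjecture.Cruxes.H413.K2E3HC13LieZeroStretching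

/-! ## §1 The annulus bound: finitely many `𝔤₀`-windows cover a compact set missing `0` -/

section Annulus

variable {K : Type*} [Field K] [Valued K ℤᵐ⁰] [ValuativeRel K] [IsNonarchimedeanLocalField K]
  (σ : K →+* K) {J : Matrix (Fin 3) (Fin 3) K}
  [MeasurableSpace ↥(unitaryGroupOfForm σ J)] [BorelSpace ↥(unitaryGroupOfForm σ J)] (μ : Measure ↥(unitaryGroupOfForm σ J))
  [MeasurableSpace (Matrix (Fin 3) (Fin 3) K)] [BorelSpace (Matrix (Fin 3) (Fin 3) K)]

/-- **THE ANNULUS BOUND** ([HarishChandra1970] Part VI §7: «since `0 ∉ Supp(f_t − f)`, `C = sup |Φ_{f_t−f}| < ∞`»).  If every non-zero point of `𝔰𝔲(σ,J)`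
(`X₀ ∈ 𝔲`, `tr X₀ = 0`) is GOOD (it has a window `V` and a constant `C` bounding `|discr χ_X|^{1∕4} ∫ Θ(gXg⁻¹)` by `C·M` for all Borel `Θ ≤ M` supported in `V`
and all trace-zero admissible `X`) and `σ` is continuous (so `𝔲` is closed; points off `𝔲`, resp. of non-zero trace, have the windows `𝔲ᶜ`, resp. `{tr ≠ 0}`,
meeting no orbit of `𝔰𝔲`), then for every compact `A ∌ 0` ONE constant bounds `|discr χ_X|^{1∕4} ∫ Θ(gXg⁻¹) ≤ C·M` for all Borel `Θ ≤ M` supported in `A`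
and all trace-zero admissible `X`: cover `A` by finitely many windows and split `Θ ≤ Σ_z 𝟙_{V_z}Θ`. [cite: HarishChandra1970, Part VI §7 pp. 59–60; Part VI §2 p. 51] -/
theorem exists_const_of_isCompact_zero_notMem (hσc : Continuous σ)
    (hgood : ∀ X₀ : Matrix (Fin 3) (Fin 3) K, X₀ ≠ 0 → (X₀.map σ).transpose * J + J * X₀ = 0 → Matrix.trace X₀ = 0 →
      ∃ V ∈ 𝓝 X₀, ∃ C : ℝ≥0, ∀ Θ : Matrix (Fin 3) (Fin 3) K → ℝ≥0∞, Measurable Θ → (∀ X, Θ X ≠ 0 → X ∈ V) → ∀ M : ℝ≥0∞, (∀ X, Θ X ≤ M) →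
        ∀ X : Matrix (Fin 3) (Fin 3) K, (X.map σ).transpose * J + J * X = 0 → Matrix.trace X = 0 → X.charpoly.discr ≠ 0 →
          IsCompact {g : ↥(unitaryGroupOfForm σ J) |
            ((g : GL (Fin 3) K) : Matrix (Fin 3) (Fin 3) K) * X * (((g : GL (Fin 3) K)⁻¹ : GL (Fin 3) K) : Matrix (Fin 3) (Fin 3) K) = X} →
            ((normAbs K X.charpoly.discr : ℝ≥0) : ℝ≥0∞) ^ (1 / 4 : ℝ) *
              ∫⁻ g, Θ (((g : GL (Fin 3) K) : Matrix (Fin 3) (Fin 3) K) * X * (((g : GL (Fin 3) K)⁻¹ : GL (Fin 3) K) : Matrix (Fin 3) (Fin 3) K)) ∂μ ≤ C * M)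
    {A : Set (Matrix (Fin 3) (Fin 3) K)} (hA : IsCompact A) (h0 : (0 : Matrix (Fin 3) (Fin 3) K) ∉ A) :
    ∃ C : ℝ≥0, ∀ Θ : Matrix (Fin 3) (Fin 3) K → ℝ≥0∞, Measurable Θ → (∀ X, Θ X ≠ 0 → X ∈ A) → ∀ M : ℝ≥0∞, (∀ X, Θ X ≤ M) →
      ∀ X : Matrix (Fin 3) (Fin 3) K, (X.map σ).transpose * J + J * X = 0 → Matrix.trace X = 0 → X.charpoly.discr ≠ 0 →
        IsCompact {g : ↥(unitaryGroupOfForm σ J) |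
          ((g : GL (Fin 3) K) : Matrix (Fin 3) (Fin 3) K) * X * (((g : GL (Fin 3) K)⁻¹ : GL (Fin 3) K) : Matrix (Fin 3) (Fin 3) K) = X} →
          ((normAbs K X.charpoly.discr : ℝ≥0) : ℝ≥0∞) ^ (1 / 4 : ℝ) *
            ∫⁻ g, Θ (((g : GL (Fin 3) K) : Matrix (Fin 3) (Fin 3) K) * X * (((g : GL (Fin 3) K)⁻¹ : GL (Fin 3) K) : Matrix (Fin 3) (Fin 3) K)) ∂μ ≤ C * M := by
  classical
  -- the Lie algebra is closed (`σ` continuous)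
  have h𝔲 : IsClosed {X : Matrix (Fin 3) (Fin 3) K | (X.map σ).transpose * J + J * X = 0} := by
    have hc : Continuous fun X : Matrix (Fin 3) (Fin 3) K => (X.map σ).transpose * J + J * X :=
      (((continuous_id.matrix_map hσc).matrix_transpose).mul continuous_const).add (continuous_const.mul continuous_id)
    exact isClosed_eq hc continuous_const
  -- an OPEN window with a constant at every point of `A`
  have hloc : ∀ Z ∈ A, ∃ V : Set (Matrix (Fin 3) (Fin 3) K), IsOpen V ∧ Z ∈ V ∧ ∃ C : ℝ≥0,
      ∀ Θ : Matrix (Fin 3) (Fin 3) K → ℝ≥0∞, Measurable Θ → (∀ X, Θ X ≠ 0 → X ∈ V) → ∀ M : ℝ≥0∞, (∀ X, Θ X ≤ M) →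
        ∀ X : Matrix (Fin 3) (Fin 3) K, (X.map σ).transpose * J + J * X = 0 → Matrix.trace X = 0 → X.charpoly.discr ≠ 0 →
          IsCompact {g : ↥(unitaryGroupOfForm σ J) |
            ((g : GL (Fin 3) K) : Matrix (Fin 3) (Fin 3) K) * X * (((g : GL (Fin 3) K)⁻¹ : GL (Fin 3) K) : Matrix (Fin 3) (Fin 3) K) = X} →
            ((normAbs K X.charpoly.discr : ℝ≥0) : ℝ≥0∞) ^ (1 / 4 : ℝ) *
              ∫⁻ g, Θ (((g : GL (Fin 3) K) : Matrix (Fin 3) (Fin 3) K) * X * (((g : GL (Fin 3) K)⁻¹ : GL (Fin 3) K) : Matrix (Fin 3) (Fin 3) K)) ∂μ ≤ C * M := by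
    intro Z hZ
    by_cases hZ𝔲 : (Z.map σ).transpose * J + J * Z = 0
    · by_cases hZtr : Matrix.trace Z = 0
      · -- a non-zero point of `𝔰𝔲`: the window of `hgood`
        have hZ0 : Z ≠ 0 := fun h => h0 (h ▸ hZ)
        obtain ⟨V, hV, C, hC⟩ := hgood Z hZ0 hZ𝔲 hZtr
        refine ⟨interior V, isOpen_interior, mem_interior_iff_mem_nhds.2 hV, C, ?_⟩
        intro Θ hΘm hΘV M hM X hX htr hreg hcpt
        exact hC Θ hΘm (fun Y hY => interior_subset (hΘV Y hY)) M hM X hX htr hreg hcpt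
      · -- a point of `𝔲` with non-zero trace: the open set `{tr ≠ 0}` meets no orbit of a trace-zero `X`
        refine ⟨{X : Matrix (Fin 3) (Fin 3) K | Matrix.trace X = 0}ᶜ, (isClosed_eq (continuous_id.matrix_trace) continuous_const).isOpen_compl, hZtr, 0, ?_⟩
        intro Θ _ hΘV M _ X _ htr _ _
        have hzero : ∀ g : ↥(unitaryGroupOfForm σ J),
            Θ (((g : GL (Fin 3) K) : Matrix (Fin 3) (Fin 3) K) * X * (((g : GL (Fin 3) K)⁻¹ : GL (Fin 3) K) : Matrix (Fin 3) (Fin 3) K)) = 0 := by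
          intro g
          by_contra hne
          refine hΘV _ hne ?_
          show Matrix.trace (((g : GL (Fin 3) K) : Matrix (Fin 3) (Fin 3) K) * X * (((g : GL (Fin 3) K)⁻¹ : GL (Fin 3) K) : Matrix (Fin 3) (Fin 3) K)) = 0
          have h2 := charpoly_coeff_two (((g : GL (Fin 3) K) : Matrix (Fin 3) (Fin 3) K) * X * (((g : GL (Fin 3) K)⁻¹ : GL (Fin 3) K) : Matrix (Fin 3) (Fin 3) K))
          rw [charpoly_conj σ g X, charpoly_coeff_two, htr] at h2
          exact neg_injective h2.symm
        simp only [hzero, lintegral_zero, mul_zero, zero_le]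
    · -- a point off `𝔲`: the open set `𝔲ᶜ` meets no orbit of `𝔲`
      refine ⟨{X : Matrix (Fin 3) (Fin 3) K | (X.map σ).transpose * J + J * X = 0}ᶜ, h𝔲.isOpen_compl, hZ𝔲, 0, ?_⟩
      intro Θ _ hΘV M _ X hX _ _ _
      have hzero : ∀ g : ↥(unitaryGroupOfForm σ J),
          Θ (((g : GL (Fin 3) K) : Matrix (Fin 3) (Fin 3) K) * X * (((g : GL (Fin 3) K)⁻¹ : GL (Fin 3) K) : Matrix (Fin 3) (Fin 3) K)) = 0 := by
        intro g
        by_contra hne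
        exact hΘV _ hne (mem_lieU_conj σ g hX)
      simp only [hzero, lintegral_zero, mul_zero, zero_le]
  choose! V hVo hZV C hC using hloc
  obtain ⟨t, ht⟩ := hA.elim_finite_subcover (fun z : ↥A => V (z : Matrix (Fin 3) (Fin 3) K)) (fun z => hVo z z.2)
    (fun Z hZ => Set.mem_iUnion.2 ⟨⟨Z, hZ⟩, hZV Z hZ⟩)
  refine ⟨∑ z ∈ t, C (z : Matrix (Fin 3) (Fin 3) K), fun Θ hΘm hΘA M hM X hX htr hreg hcpt => ?_⟩
  -- split `Θ ≤ Σ_z 𝟙_{V_z} Θ`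
  have hsplit : ∀ Y, Θ Y ≤ ∑ z ∈ t, (V (z : Matrix (Fin 3) (Fin 3) K)).indicator Θ Y := by
    intro Y
    by_cases hY : Θ Y = 0
    · rw [hY]; exact zero_le
    · have hYA : Y ∈ A := hΘA Y hY
      obtain ⟨z, hzt, hYz⟩ : ∃ z ∈ t, Y ∈ V (z : Matrix (Fin 3) (Fin 3) K) := by
        have := ht hYA
        simp only [Set.mem_iUnion, exists_prop] at this
        exact this
      calc Θ Y = (V (z : Matrix (Fin 3) (Fin 3) K)).indicator Θ Y := (Set.indicator_of_mem hYz Θ).symm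
        _ ≤ ∑ z ∈ t, (V (z : Matrix (Fin 3) (Fin 3) K)).indicator Θ Y :=
          Finset.single_le_sum (f := fun z : ↥A => (V (z : Matrix (Fin 3) (Fin 3) K)).indicator Θ Y) (fun _ _ => zero_le) hzt
  -- each piece is Borel, supported in its window, and `≤ M`
  have hpiece : ∀ z ∈ t, ((normAbs K X.charpoly.discr : ℝ≥0) : ℝ≥0∞) ^ (1 / 4 : ℝ) *
      ∫⁻ g, (V (z : Matrix (Fin 3) (Fin 3) K)).indicator Θ
        (((g : GL (Fin 3) K) : Matrix (Fin 3) (Fin 3) K) * X * (((g : GL (Fin 3) K)⁻¹ : GL (Fin 3) K) : Matrix (Fin 3) (Fin 3) K)) ∂μ ≤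
        C (z : Matrix (Fin 3) (Fin 3) K) * M := by
    intro z _
    refine hC z z.2 _ (hΘm.indicator (hVo z z.2).measurableSet) (fun Y hY => Set.mem_of_indicator_ne_zero hY) M
      (fun Y => (Set.indicator_le_self _ _ Y).trans (hM Y)) X hX htr hreg hcpt
  calc ((normAbs K X.charpoly.discr : ℝ≥0) : ℝ≥0∞) ^ (1 / 4 : ℝ) *
        ∫⁻ g, Θ (((g : GL (Fin 3) K) : Matrix (Fin 3) (Fin 3) K) * X * (((g : GL (Fin 3) K)⁻¹ : GL (Fin 3) K) : Matrix (Fin 3) (Fin 3) K)) ∂μ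
      ≤ ((normAbs K X.charpoly.discr : ℝ≥0) : ℝ≥0∞) ^ (1 / 4 : ℝ) *
        ∫⁻ g, ∑ z ∈ t, (V (z : Matrix (Fin 3) (Fin 3) K)).indicator Θ
          (((g : GL (Fin 3) K) : Matrix (Fin 3) (Fin 3) K) * X * (((g : GL (Fin 3) K)⁻¹ : GL (Fin 3) K) : Matrix (Fin 3) (Fin 3) K)) ∂μ := by
        gcongr
        exact hsplit _
    _ = ∑ z ∈ t, ((normAbs K X.charpoly.discr : ℝ≥0) : ℝ≥0∞) ^ (1 / 4 : ℝ) *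
        ∫⁻ g, (V (z : Matrix (Fin 3) (Fin 3) K)).indicator Θ
          (((g : GL (Fin 3) K) : Matrix (Fin 3) (Fin 3) K) * X * (((g : GL (Fin 3) K)⁻¹ : GL (Fin 3) K) : Matrix (Fin 3) (Fin 3) K)) ∂μ := by
        rw [lintegral_finsetSum _ (fun (z : ↥A) _ => measurable_comp_conj σ (hΘm.indicator (hVo z z.2).measurableSet) X), Finset.mul_sum]
    _ ≤ ∑ z ∈ t, (C (z : Matrix (Fin 3) (Fin 3) K) : ℝ≥0∞) * M := Finset.sum_le_sum hpiece
    _ = ((∑ z ∈ t, C (z : Matrix (Fin 3) (Fin 3) K) : ℝ≥0) : ℝ≥0∞) * M := by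
        push_cast
        rw [Finset.sum_mul]

end Annulus

/-! ## §2 The stretching step and HARISH-CHANDRA'S THEOREM 13 AT THE ORIGIN -/

section Main

variable {K : Type*} [Field K] [Valued K ℤᵐ⁰] [ValuativeRel K] [IsNonarchimedeanLocalField K]
  (σ : K →+* K) {J : Matrix (Fin 3) (Fin 3) K}
  [MeasurableSpace ↥(unitaryGroupOfForm σ J)] [BorelSpace ↥(unitaryGroupOfForm σ J)] (μ : Measure ↥(unitaryGroupOfForm σ J))
  [MeasurableSpace (Matrix (Fin 3) (Fin 3) K)] [BorelSpace (Matrix (Fin 3) (Fin 3) K)]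

/-- **THE STRETCHING IDENTITY** ([HarishChandra1970] Part VI §7: `Φ_f(t⁻¹H) = |t|^{-(n-ℓ)∕2}(Φ_f(H) + Φ_{f_t − f}(H))` with `f = 𝟙_B`, `B = M₃(𝔭^k)`,
`t⁻¹ = p`, `|p|_K = (q⁻¹)^e`, `f_t − f = 𝟙_{M₃(𝔭^{k−e}) ∖ B}`):
`|discr χ_{pY}|^{1∕4} Φ(𝟙_B, pY) = κ · |discr χ_Y|^{1∕4} Φ(𝟙_B, Y) + κ · |discr χ_Y|^{1∕4} Φ(𝟙_{M₃(𝔭^{k−e}) ∖ B}, Y)`, `κ = (|p|_K⁶)^{1∕4}`.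
[cite: HarishChandra1970, Part VI §7 pp. 59–60] -/
theorem stretching_step {a : K} {e : ℤ} (he : normAbs K a = ((residueFieldCard K : ℝ≥0)⁻¹) ^ e) (ha1 : normAbs K a ≤ 1) (k : ℤ)
    (Y : Matrix (Fin 3) (Fin 3) K) :
    ((normAbs K (a • Y).charpoly.discr : ℝ≥0) : ℝ≥0∞) ^ (1 / 4 : ℝ) *
        ∫⁻ g, ({Y : Matrix (Fin 3) (Fin 3) K | ∀ i j, Y i j ∈ primePowBall K k}).indicator (fun _ => (1 : ℝ≥0∞))
          (((g : GL (Fin 3) K) : Matrix (Fin 3) (Fin 3) K) * (a • Y) * (((g : GL (Fin 3) K)⁻¹ : GL (Fin 3) K) : Matrix (Fin 3) (Fin 3) K)) ∂μ =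
      (((normAbs K a ^ 6) ^ (1 / 4 : ℝ) : ℝ≥0) : ℝ≥0∞) *
          (((normAbs K Y.charpoly.discr : ℝ≥0) : ℝ≥0∞) ^ (1 / 4 : ℝ) *
            ∫⁻ g, ({Y : Matrix (Fin 3) (Fin 3) K | ∀ i j, Y i j ∈ primePowBall K k}).indicator (fun _ => (1 : ℝ≥0∞))
              (((g : GL (Fin 3) K) : Matrix (Fin 3) (Fin 3) K) * Y * (((g : GL (Fin 3) K)⁻¹ : GL (Fin 3) K) : Matrix (Fin 3) (Fin 3) K)) ∂μ) +
        (((normAbs K a ^ 6) ^ (1 / 4 : ℝ) : ℝ≥0) : ℝ≥0∞) *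
          (((normAbs K Y.charpoly.discr : ℝ≥0) : ℝ≥0∞) ^ (1 / 4 : ℝ) *
            ∫⁻ g, ({Y : Matrix (Fin 3) (Fin 3) K | ∀ i j, Y i j ∈ primePowBall K (k - e)} \
                {Y : Matrix (Fin 3) (Fin 3) K | ∀ i j, Y i j ∈ primePowBall K k}).indicator (fun _ => (1 : ℝ≥0∞))
              (((g : GL (Fin 3) K) : Matrix (Fin 3) (Fin 3) K) * Y * (((g : GL (Fin 3) K)⁻¹ : GL (Fin 3) K) : Matrix (Fin 3) (Fin 3) K)) ∂μ) := by
  classical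
  set B : Set (Matrix (Fin 3) (Fin 3) K) := {Y : Matrix (Fin 3) (Fin 3) K | ∀ i j, Y i j ∈ primePowBall K k} with hBdef
  set B' : Set (Matrix (Fin 3) (Fin 3) K) := {Y : Matrix (Fin 3) (Fin 3) K | ∀ i j, Y i j ∈ primePowBall K (k - e)} with hB'def
  have hBB' : B ⊆ B' := fun Z hZ => (smul_mem_box_iff he k Z).1 (smul_mem_box ha1 hZ)
  -- pointwise: `𝟙_B(a • Z) = 𝟙_{B'}(Z) = 𝟙_B(Z) + 𝟙_{B' \ B}(Z)`
  have hpt : ∀ Z : Matrix (Fin 3) (Fin 3) K,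
      B.indicator (fun _ => (1 : ℝ≥0∞)) (a • Z) = B.indicator (fun _ => (1 : ℝ≥0∞)) Z + (B' \ B).indicator (fun _ => (1 : ℝ≥0∞)) Z := by
    intro Z
    have hiff : a • Z ∈ B ↔ Z ∈ B' := smul_mem_box_iff he k Z
    by_cases hZ : Z ∈ B
    · have hZ' : Z ∈ B' := hBB' hZ
      rw [Set.indicator_of_mem (hiff.2 hZ'), Set.indicator_of_mem hZ, Set.indicator_of_notMem (fun h => h.2 hZ), add_zero]
    · by_cases hZ' : Z ∈ B'
      · rw [Set.indicator_of_mem (hiff.2 hZ'), Set.indicator_of_notMem hZ, Set.indicator_of_mem (show Z ∈ B' \ B from ⟨hZ', hZ⟩), zero_add]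
      · rw [Set.indicator_of_notMem (fun h => hZ' (hiff.1 h)), Set.indicator_of_notMem hZ, Set.indicator_of_notMem (fun h => hZ' h.1),
          add_zero]
  have hmeas : Measurable fun g : ↥(unitaryGroupOfForm σ J) => B.indicator (fun _ => (1 : ℝ≥0∞))
      (((g : GL (Fin 3) K) : Matrix (Fin 3) (Fin 3) K) * Y * (((g : GL (Fin 3) K)⁻¹ : GL (Fin 3) K) : Matrix (Fin 3) (Fin 3) K)) :=
    measurable_comp_conj σ (measurable_const.indicator (isOpen_box k).measurableSet) Y
  simp_rw [conj_smul, hpt]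
  rw [lintegral_add_left hmeas, weight_smul, mul_assoc, mul_add, mul_add]

/-- **HARISH-CHANDRA'S THEOREM 13 AT THE ORIGIN OF `𝔰𝔲` BY STRETCHING** ([HarishChandra1970] Part VI §7 «Completion of the proof of Theorem 13», on the semisimple
part `𝔰𝔲 = {X ∈ 𝔲(σ,J) | tr X = 0}` as in VI §1 Lemmas 26–27, in the currency of the Lie letter `sig_K2E3HC13LieEllRankOne` of road HC-14-ell).  HYPOTHESIS `hgood` =
Harish-Chandra's «`𝔤₁ ∖ {0} ⊆ 𝔤₀`» ([HC1970, VI §2 p. 51]): every NON-ZERO `X₀ ∈ 𝔲` with `tr X₀ = 0` has a window `V ∈ 𝓝 X₀` and a constant `C` such that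
`|discr χ_X|_K^{1∕4} · ∫_U Θ(gXg⁻¹) dμ(g) ≤ C · M` for every Borel `Θ : M₃(K) → [0,∞]` vanishing off `V` and bounded by `M`, and every trace-zero admissible `X`
(`X ∈ 𝔲`, `tr X = 0`, `discr χ_X ≠ 0`, compact centraliser) — the support of `Θ` is localised NEAR `X₀`, the point `X` is NOT (for non-nilpotent `X₀ = s + n`,
`s ≠ 0` non-central, this is HC's Lemma 29 = semisimple descent; for nilpotent `X₀ ≠ 0` it is Lemma 38; a central `X₀ = a·1 ≠ 0` is excluded by `tr X₀ = 0` —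
there the property would be the theorem itself).  CONCLUSION: the letter at EVERY compact `S ⊆ M₃(K)` for trace-zero admissible `X` — one constant `C` with
`|discr χ_X|_K^{1∕4} · ∫_U Θ(gXg⁻¹) dμ ≤ C · M` for all Borel `Θ ≤ M` vanishing off `S`; the centre is restored by ★ `K2E3HC13LieCentreReduction`.  PROOF (HC §7 verbatim): with the
`σ`-fixed scalar `p` (`0 < |p|_K < 1`, ★ `exists_natCast_normAbs_lt_one`) and a box `B = M₃(𝔭^k) ⊇ S` (★ `exists_subset_box`), the stretching identity
(★ `stretching_step`) and the annulus bound on the compact set `M₃(𝔭^{k−e}) ∖ B ∌ 0` (★ `exists_const_of_isCompact_zero_notMem`) give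
`a(pY) ≤ κ a(Y) + κ C₁` for `a(Y) = |discr χ_Y|^{1∕4} Φ(𝟙_B, Y)`, `κ = |p|_K^{3∕2} < 1`; since `a(p^{-m}X) = 0` for `m ≫ 0` (★ `exists_pow_smul_forall_conj_notMem_box`),
descending induction along `p^{-m}X, …, p^{-1}X, X` yields `a(X) ≤ κC₁∕(1−κ) =: D`, and `Θ ≤ M 𝟙_B` gives the letter with `C = D`.  The measure `μ` is
arbitrary (no invariance is used); `σ` is only assumed continuous (so that `𝔲` is closed).
[cite: HarishChandra1970, Part VI §7 pp. 59–60; Part V §3 Theorem 13 p. 44] [cite: Rogawski1990, §7.3 p. 97] -/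
theorem hc13Lie_traceZero_of_forall_ne_zero [CharZero K] (hσc : Continuous σ)
    (hgood : ∀ X₀ : Matrix (Fin 3) (Fin 3) K, X₀ ≠ 0 → (X₀.map σ).transpose * J + J * X₀ = 0 → Matrix.trace X₀ = 0 →
      ∃ V ∈ 𝓝 X₀, ∃ C : ℝ≥0, ∀ Θ : Matrix (Fin 3) (Fin 3) K → ℝ≥0∞, Measurable Θ → (∀ X, Θ X ≠ 0 → X ∈ V) → ∀ M : ℝ≥0∞, (∀ X, Θ X ≤ M) →
        ∀ X : Matrix (Fin 3) (Fin 3) K, (X.map σ).transpose * J + J * X = 0 → Matrix.trace X = 0 → X.charpoly.discr ≠ 0 →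
          IsCompact {g : ↥(unitaryGroupOfForm σ J) |
            ((g : GL (Fin 3) K) : Matrix (Fin 3) (Fin 3) K) * X * (((g : GL (Fin 3) K)⁻¹ : GL (Fin 3) K) : Matrix (Fin 3) (Fin 3) K) = X} →
            ((normAbs K X.charpoly.discr : ℝ≥0) : ℝ≥0∞) ^ (1 / 4 : ℝ) *
              ∫⁻ g, Θ (((g : GL (Fin 3) K) : Matrix (Fin 3) (Fin 3) K) * X * (((g : GL (Fin 3) K)⁻¹ : GL (Fin 3) K) : Matrix (Fin 3) (Fin 3) K)) ∂μ ≤ C * M)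
    {S : Set (Matrix (Fin 3) (Fin 3) K)} (hS : IsCompact S) :
    ∃ C : ℝ≥0, ∀ Θ : Matrix (Fin 3) (Fin 3) K → ℝ≥0∞, Measurable Θ → (∀ X, Θ X ≠ 0 → X ∈ S) → ∀ M : ℝ≥0∞, (∀ X, Θ X ≤ M) →
      ∀ X : Matrix (Fin 3) (Fin 3) K, (X.map σ).transpose * J + J * X = 0 → Matrix.trace X = 0 → X.charpoly.discr ≠ 0 →
        IsCompact {g : ↥(unitaryGroupOfForm σ J) |
          ((g : GL (Fin 3) K) : Matrix (Fin 3) (Fin 3) K) * X * (((g : GL (Fin 3) K)⁻¹ : GL (Fin 3) K) : Matrix (Fin 3) (Fin 3) K) = X} →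
          ((normAbs K X.charpoly.discr : ℝ≥0) : ℝ≥0∞) ^ (1 / 4 : ℝ) *
            ∫⁻ g, Θ (((g : GL (Fin 3) K) : Matrix (Fin 3) (Fin 3) K) * X * (((g : GL (Fin 3) K)⁻¹ : GL (Fin 3) K) : Matrix (Fin 3) (Fin 3) K)) ∂μ ≤ C * M := by
  classical
  -- the stretching scalar `p` and its exponent `e`
  obtain ⟨p, hp0, hp1⟩ := exists_natCast_normAbs_lt_one (K := K)
  obtain ⟨e, he⟩ := exists_normAbs_eq_inv_zpow hp0
  have hσp : σ (p : K) = p := map_natCast σ p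
  have hσp' : σ ((p : K)⁻¹) = (p : K)⁻¹ := by rw [map_inv₀, hσp]
  have hp0' : ((p : K)⁻¹) ≠ 0 := inv_ne_zero hp0
  -- the box `B ⊇ S`, the bigger box `B'` with `p • Z ∈ B ↔ Z ∈ B'`, the compact annulus `B' \ B ∌ 0`
  obtain ⟨k, hSk⟩ := exists_subset_box hS
  set B : Set (Matrix (Fin 3) (Fin 3) K) := {Y : Matrix (Fin 3) (Fin 3) K | ∀ i j, Y i j ∈ primePowBall K k} with hBdef
  set B' : Set (Matrix (Fin 3) (Fin 3) K) := {Y : Matrix (Fin 3) (Fin 3) K | ∀ i j, Y i j ∈ primePowBall K (k - e)} with hB'def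
  have hA : IsCompact (B' \ B) := (isCompact_box (k - e)).diff (isOpen_box k)
  have h0A : (0 : Matrix (Fin 3) (Fin 3) K) ∉ B' \ B := fun h => h.2 (zero_mem_box k)
  obtain ⟨C₁, hC₁⟩ := exists_const_of_isCompact_zero_notMem σ μ hσc hgood hA h0A
  have hAm : MeasurableSet (B' \ B) := (isOpen_box (k - e)).measurableSet.diff (isOpen_box k).measurableSet
  have hBm : MeasurableSet B := (isOpen_box k).measurableSet
  -- the annulus bound for the indicator
  have hann : ∀ Y : Matrix (Fin 3) (Fin 3) K, (Y.map σ).transpose * J + J * Y = 0 → Matrix.trace Y = 0 → Y.charpoly.discr ≠ 0 →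
      IsCompact {g : ↥(unitaryGroupOfForm σ J) |
        ((g : GL (Fin 3) K) : Matrix (Fin 3) (Fin 3) K) * Y * (((g : GL (Fin 3) K)⁻¹ : GL (Fin 3) K) : Matrix (Fin 3) (Fin 3) K) = Y} →
      ((normAbs K Y.charpoly.discr : ℝ≥0) : ℝ≥0∞) ^ (1 / 4 : ℝ) *
        ∫⁻ g, (B' \ B).indicator (fun _ => (1 : ℝ≥0∞))
          (((g : GL (Fin 3) K) : Matrix (Fin 3) (Fin 3) K) * Y * (((g : GL (Fin 3) K)⁻¹ : GL (Fin 3) K) : Matrix (Fin 3) (Fin 3) K)) ∂μ ≤ C₁ := by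
    intro Y hY htr hreg hcpt
    have h := hC₁ ((B' \ B).indicator (fun _ => (1 : ℝ≥0∞))) (measurable_const.indicator hAm) (fun Z hZ => Set.mem_of_indicator_ne_zero hZ) 1
      (fun Z => Set.indicator_le (fun _ _ => le_rfl) Z) Y hY htr hreg hcpt
    simpa only [mul_one] using h
  -- the contraction constant `κ = (|p|⁶)^{1∕4} < 1` and the bound `D = κ C₁ ∕ (1 − κ)`
  set κ : ℝ≥0 := (normAbs K (p : K) ^ 6) ^ (1 / 4 : ℝ) with hκdef
  have hκ1 : κ < 1 := NNReal.rpow_lt_one (pow_lt_one₀ zero_le hp1 (by norm_num)) (by norm_num)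
  set D : ℝ≥0 := κ * C₁ / (1 - κ) with hDdef
  have hD : (κ : ℝ≥0∞) * D + κ * C₁ ≤ D := by
    have h1 : (0 : ℝ) < 1 - (κ : ℝ) := by
      have : (κ : ℝ) < 1 := by exact_mod_cast hκ1
      linarith
    rw [← ENNReal.coe_mul, ← ENNReal.coe_mul, ← ENNReal.coe_add, ENNReal.coe_le_coe, ← NNReal.coe_le_coe]
    push_cast [hDdef, NNReal.coe_sub hκ1.le]
    rw [show (κ : ℝ) * ((κ : ℝ) * C₁ / (1 - κ)) + κ * C₁ = (κ : ℝ) * C₁ / (1 - κ) by field_simp; ring]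
  -- notation-free abbreviation of `a(Y) = |discr χ_Y|^{1/4} Φ(𝟙_B, Y)` is kept inline; THE RECURSION
  have key : ∀ m : ℕ, ∀ Y : Matrix (Fin 3) (Fin 3) K, (Y.map σ).transpose * J + J * Y = 0 → Matrix.trace Y = 0 → Y.charpoly.discr ≠ 0 →
      IsCompact {g : ↥(unitaryGroupOfForm σ J) |
        ((g : GL (Fin 3) K) : Matrix (Fin 3) (Fin 3) K) * Y * (((g : GL (Fin 3) K)⁻¹ : GL (Fin 3) K) : Matrix (Fin 3) (Fin 3) K) = Y} →
      (∀ g : ↥(unitaryGroupOfForm σ J),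
        ((g : GL (Fin 3) K) : Matrix (Fin 3) (Fin 3) K) * (((p : K)⁻¹) ^ m • Y) * (((g : GL (Fin 3) K)⁻¹ : GL (Fin 3) K) : Matrix (Fin 3) (Fin 3) K) ∉ B) →
      ((normAbs K Y.charpoly.discr : ℝ≥0) : ℝ≥0∞) ^ (1 / 4 : ℝ) *
        ∫⁻ g, B.indicator (fun _ => (1 : ℝ≥0∞))
          (((g : GL (Fin 3) K) : Matrix (Fin 3) (Fin 3) K) * Y * (((g : GL (Fin 3) K)⁻¹ : GL (Fin 3) K) : Matrix (Fin 3) (Fin 3) K)) ∂μ ≤ D := by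
    intro m
    induction m with
    | zero =>
      intro Y _ _ _ _ hfar
      have hzero : ∀ g : ↥(unitaryGroupOfForm σ J), B.indicator (fun _ => (1 : ℝ≥0∞))
          (((g : GL (Fin 3) K) : Matrix (Fin 3) (Fin 3) K) * Y * (((g : GL (Fin 3) K)⁻¹ : GL (Fin 3) K) : Matrix (Fin 3) (Fin 3) K)) = 0 := by
        intro g
        have hg := hfar g
        rw [pow_zero, one_smul] at hg
        exact Set.indicator_of_notMem hg _
      simp only [hzero, lintegral_zero, mul_zero, zero_le]
    | succ m ih =>
      intro Y hY htr hreg hcpt hfar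
      -- `Y = p • Y'` with `Y' = p⁻¹ • Y` admissible and one step further out
      set Y' : Matrix (Fin 3) (Fin 3) K := ((p : K)⁻¹) • Y with hY'def
      have hYY' : Y = (p : K) • Y' := by rw [hY'def, smul_smul, mul_inv_cancel₀ hp0, one_smul]
      have hY' : (Y'.map σ).transpose * J + J * Y' = 0 := smul_mem_lieU σ hσp' hY
      have htr' : Matrix.trace Y' = 0 := by rw [hY'def, Matrix.trace_smul, htr, smul_zero]
      have hreg' : Y'.charpoly.discr ≠ 0 := by
        rw [hY'def, charpoly_discr_smul]
        exact mul_ne_zero (pow_ne_zero _ hp0') hreg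
      have hcpt' : IsCompact {g : ↥(unitaryGroupOfForm σ J) |
          ((g : GL (Fin 3) K) : Matrix (Fin 3) (Fin 3) K) * Y' * (((g : GL (Fin 3) K)⁻¹ : GL (Fin 3) K) : Matrix (Fin 3) (Fin 3) K) = Y'} := by
        rw [hY'def, centralizerSet_smul σ hp0']
        exact hcpt
      have hfar' : ∀ g : ↥(unitaryGroupOfForm σ J),
          ((g : GL (Fin 3) K) : Matrix (Fin 3) (Fin 3) K) * (((p : K)⁻¹) ^ m • Y') * (((g : GL (Fin 3) K)⁻¹ : GL (Fin 3) K) : Matrix (Fin 3) (Fin 3) K) ∉ B := by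
        intro g
        have hg := hfar g
        rwa [pow_succ, ← smul_smul] at hg
      have hih := ih Y' hY' htr' hreg' hcpt' hfar'
      have hann' := hann Y' hY' htr' hreg' hcpt'
      have hstep := stretching_step σ μ he hp1.le k Y'
      rw [hYY', hstep]
      calc (κ : ℝ≥0∞) * (((normAbs K Y'.charpoly.discr : ℝ≥0) : ℝ≥0∞) ^ (1 / 4 : ℝ) *
              ∫⁻ g, B.indicator (fun _ => (1 : ℝ≥0∞))
                (((g : GL (Fin 3) K) : Matrix (Fin 3) (Fin 3) K) * Y' * (((g : GL (Fin 3) K)⁻¹ : GL (Fin 3) K) : Matrix (Fin 3) (Fin 3) K)) ∂μ) +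
            (κ : ℝ≥0∞) * (((normAbs K Y'.charpoly.discr : ℝ≥0) : ℝ≥0∞) ^ (1 / 4 : ℝ) *
              ∫⁻ g, (B' \ B).indicator (fun _ => (1 : ℝ≥0∞))
                (((g : GL (Fin 3) K) : Matrix (Fin 3) (Fin 3) K) * Y' * (((g : GL (Fin 3) K)⁻¹ : GL (Fin 3) K) : Matrix (Fin 3) (Fin 3) K)) ∂μ)
          ≤ (κ : ℝ≥0∞) * D + κ * C₁ := by gcongr
        _ ≤ D := hD
  -- THE LETTER with `C = D`
  refine ⟨D, fun Θ hΘm hΘS M hM X hX htr hreg hcpt => ?_⟩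
  obtain ⟨m, hm⟩ := exists_pow_smul_forall_conj_notMem_box σ (J := J) k hp0 hp1 hreg
  have haX := key m X hX htr hreg hcpt hm
  have hΘB : ∀ Z, Θ Z ≤ M * B.indicator (fun _ => (1 : ℝ≥0∞)) Z := by
    intro Z
    by_cases hZ : Θ Z = 0
    · rw [hZ]; exact zero_le
    · rw [Set.indicator_of_mem (hSk (hΘS Z hZ)), mul_one]
      exact hM Z
  have hmeas : Measurable fun g : ↥(unitaryGroupOfForm σ J) => B.indicator (fun _ => (1 : ℝ≥0∞))
      (((g : GL (Fin 3) K) : Matrix (Fin 3) (Fin 3) K) * X * (((g : GL (Fin 3) K)⁻¹ : GL (Fin 3) K) : Matrix (Fin 3) (Fin 3) K)) :=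
    measurable_comp_conj σ (measurable_const.indicator hBm) X
  calc ((normAbs K X.charpoly.discr : ℝ≥0) : ℝ≥0∞) ^ (1 / 4 : ℝ) *
        ∫⁻ g, Θ (((g : GL (Fin 3) K) : Matrix (Fin 3) (Fin 3) K) * X * (((g : GL (Fin 3) K)⁻¹ : GL (Fin 3) K) : Matrix (Fin 3) (Fin 3) K)) ∂μ
      ≤ ((normAbs K X.charpoly.discr : ℝ≥0) : ℝ≥0∞) ^ (1 / 4 : ℝ) *
        ∫⁻ g, M * B.indicator (fun _ => (1 : ℝ≥0∞))
          (((g : GL (Fin 3) K) : Matrix (Fin 3) (Fin 3) K) * X * (((g : GL (Fin 3) K)⁻¹ : GL (Fin 3) K) : Matrix (Fin 3) (Fin 3) K)) ∂μ := by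
        gcongr
        exact hΘB _
    _ = M * (((normAbs K X.charpoly.discr : ℝ≥0) : ℝ≥0∞) ^ (1 / 4 : ℝ) *
        ∫⁻ g, B.indicator (fun _ => (1 : ℝ≥0∞))
          (((g : GL (Fin 3) K) : Matrix (Fin 3) (Fin 3) K) * X * (((g : GL (Fin 3) K)⁻¹ : GL (Fin 3) K) : Matrix (Fin 3) (Fin 3) K)) ∂μ) := by
        rw [lintegral_const_mul _ hmeas, mul_left_comm]
    _ ≤ M * D := by gcongr
    _ = D * M := mul_comm _ _

end Main




end Summit.HodgeConjecture.HodgeConjecture.Cruxes.H413.K2E3HC13LieZeroStretching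

end
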